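import Literature.NumberTheory.ModularForms.QAsymptoticsTheta
import HarnessLib

/-!
# Fourth-order asymptotics of `θ(τ/2,τ), U, V, W, λ` at `i∞` (CKMRV (2.8)–(2.9))

Cohn–Kumar–Miller–Radchenko–Viazovska, arXiv:1902.05438, §2.1.2: (2.8)
`U = 1 + 8q^{1/2} + 24q + 32q^{3/2} + 24q² + ⋯`, `V = 16q^{1/2} + 64q^{3/2} + 96q^{5/2} + ⋯`,
`W = 1 − 8q^{1/2} + 24q − 32q^{3/2} + 24q² − ⋯`; (2.9) `λ = 16q^{1/2} − 128q + 704q^{3/2} − 3072q² + ⋯`.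

Everything below is proved, as `IsBigO` statements along `atImInfty` (`q^{1/2} = qhalf`,
`‖qhalf‖ = expDecayHalf = e^{−πy}`):
* `norm_jacobiTheta₂_half_sub_four_le`: `‖θ(τ/2,τ) − 2 − 2e^{2πiτ}‖ ≤ e^{−6π Im τ}·K` for `Im τ ≥ 1`
  (`θ(τ/2, τ) = Σ_n e^{πi(n²+n)τ} = 2 + 2q + 2q³ + ⋯`), and `jacobiTheta₂_half_fourth_order`;
* `thetaU_fourth_order`: `U − 1 − 8q^{1/2} − 24q − 32q^{3/2} = O(e^{−4πy})`; `thetaW_fourth_order`;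
  `thetaV_fourth_order`: `V − 16q^{1/2} − 64q^{3/2} = O(e^{−5πy})`;
* `modularLambda_fourth_order`: `λ − 16q^{1/2} + 128q − 704q^{3/2} = O(e^{−4πy})`.

## References

* H. Cohn, A. Kumar, S. D. Miller, D. Radchenko, M. Viazovska, Ann. of Math. 196 (2022),
  arXiv:1902.05438, §2.1.2 (2.8)–(2.9). [CohnEtAl2019]
-/

noncomputable section

open Complex hiding I
open Filter Topology Asymptotics ModularForm SlashInvariantForm
open UpperHalfPlane hiding I
open Complex (I)
open scoped Real MatrixGroups ModularForm Manifold

namespace Literature.NumberTheory.ModularForms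

open Literature.NumberTheory.EllipticCurves.JacobiThetaNull (theta2 theta3 theta4 norm_sub_sum_le majorant
  summable_majorant majorant_nonneg exp_sq_add_le_majorant norm_jacobiTheta₂_term_half tendsto_jacobiTheta₂_half)

/-! ## `θ(τ/2, τ) = 2 + 2q + O(q³)` -/

/-- Off `{0, −1, 1, −2}`, `n² + n ≥ 6`. [folklore] -/
theorem six_le_sq_add_self {n : ℤ} (hn : n ∉ ({0, -1, 1, -2} : Finset ℤ)) : (6 : ℝ) ≤ (n : ℝ) ^ 2 + n := by
  have hn' : n ≠ 0 ∧ n ≠ -1 ∧ n ≠ 1 ∧ n ≠ -2 := by simpa using hn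
  have : (6 : ℤ) ≤ n ^ 2 + n := by
    rcases le_or_gt 2 n with h | h
    · nlinarith
    · have : n ≤ -3 := by omega
      nlinarith
  exact_mod_cast this

/-- `e^{−πwy} ≤ e^{−6πy} e^{6π} e^{−πw}` for `w ≥ 6`, `y ≥ 1`. [folklore] -/
theorem exp_weight_le_six {w y : ℝ} (hw : 6 ≤ w) (hy : 1 ≤ y) :
    Real.exp (-π * w * y) ≤ Real.exp (-6 * π * y) * (Real.exp (6 * π) * Real.exp (-π * w)) := by
  rw [← Real.exp_add, ← Real.exp_add, Real.exp_le_exp]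
  nlinarith [Real.pi_pos, mul_nonneg (sub_nonneg.2 hw) (sub_nonneg.2 hy)]

/-- **`‖θ(τ/2, τ) − 2 − 2e^{2πiτ}‖ ≤ e^{−6π Im τ}·(e^{6π}Σ majorant)`** for `Im τ ≥ 1`: the terms
`n = 0, −1` contribute `1 + 1`, the terms `n = 1, −2` contribute `q + q`, and the rest have
`n² + n ≥ 6`. [cite: CohnEtAl2019, §2.1.2 (2.8)] -/
theorem norm_jacobiTheta₂_half_sub_four_le {τ : ℂ} (hτ : 1 ≤ τ.im) :
    ‖jacobiTheta₂ (τ / 2) τ - (2 + 2 * cexp (2 * π * I * τ))‖ ≤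
      Real.exp (-6 * π * τ.im) * (Real.exp (6 * π) * ∑' n : ℤ, majorant 0 n) := by
  have hτ0 : 0 < τ.im := by linarith
  have ht := hasSum_jacobiTheta₂_term (τ / 2) hτ0
  have hz : (τ / 2).im = τ.im / 2 := by simp
  have e0 : jacobiTheta₂_term 0 (τ / 2) τ = 1 := by simp [jacobiTheta₂_term]
  have e1 : jacobiTheta₂_term (-1) (τ / 2) τ = 1 := by
    rw [jacobiTheta₂_term, show (2 * π * I * ((-1 : ℤ) : ℂ) * (τ / 2) + π * I * ((-1 : ℤ) : ℂ) ^ 2 * τ) = 0 by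
      push_cast; ring, Complex.exp_zero]
  have e2 : jacobiTheta₂_term 1 (τ / 2) τ = cexp (2 * π * I * τ) := by
    rw [jacobiTheta₂_term]; congr 1; push_cast; ring
  have e3 : jacobiTheta₂_term (-2) (τ / 2) τ = cexp (2 * π * I * τ) := by
    rw [jacobiTheta₂_term]; congr 1; push_cast; ring
  have hsum : ∑ n ∈ ({0, -1, 1, -2} : Finset ℤ), jacobiTheta₂_term n (τ / 2) τ = 2 + 2 * cexp (2 * π * I * τ) := by
    rw [Finset.sum_insert (by decide), Finset.sum_insert (by decide), Finset.sum_pair (by decide), e0, e1, e2, e3]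
    ring
  have hb : HasSum (fun n => Real.exp (-6 * π * τ.im) * (Real.exp (6 * π) * majorant 0 n))
      (Real.exp (-6 * π * τ.im) * (Real.exp (6 * π) * ∑' n : ℤ, majorant 0 n)) :=
    ((summable_majorant 0).hasSum.mul_left _).mul_left _
  have := norm_sub_sum_le ht {0, -1, 1, -2} hb
    (fun n => mul_nonneg (Real.exp_pos _).le (mul_nonneg (Real.exp_pos _).le (majorant_nonneg 0 n)))
    (fun n hn => by
      rw [norm_jacobiTheta₂_term_half hz, majorant, pow_zero, one_mul]
      refine (exp_weight_le_six (six_le_sq_add_self hn) hτ).trans ?_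
      exact mul_le_mul_of_nonneg_left (mul_le_mul_of_nonneg_left (exp_sq_add_le_majorant n)
        (Real.exp_pos _).le) (Real.exp_pos _).le)
  rwa [hsum] at this

/-- Along `atImInfty`: **`θ(τ/2,τ) − 2 − 2q = O(e^{−6πy})`**. [cite: CohnEtAl2019, §2.1.2 (2.8)] -/
theorem jacobiTheta₂_half_fourth_order :
    (fun τ : ℍ => jacobiTheta₂ ((τ : ℂ) / 2) τ - 2 - 2 * qfun τ) =O[atImInfty] fun τ => expDecayHalf τ ^ 6 := by
  refine IsBigO.of_bound (Real.exp (6 * π) * ∑' n : ℤ, majorant 0 n) ?_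
  rw [Filter.Eventually, atImInfty_mem]
  refine ⟨1, fun τ hτ => ?_⟩
  have h := norm_jacobiTheta₂_half_sub_four_le (τ := (τ : ℂ)) (by simpa using hτ)
  simp only [Set.mem_setOf_eq]
  rw [show jacobiTheta₂ ((τ : ℂ) / 2) τ - 2 - 2 * qfun τ = jacobiTheta₂ ((τ : ℂ) / 2) τ - (2 + 2 * cexp (2 * π * I * τ)) by
    rw [qfun]; ring]
  have h6 : expDecayHalf τ ^ 6 = Real.exp (-6 * π * τ.im) := by
    rw [expDecayHalf, ← Real.exp_nat_mul]; congr 1; push_cast; ring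
  rw [Real.norm_of_nonneg (pow_nonneg (expDecayHalf_pos τ).le 6), h6]
  have him : ((τ : ℂ)).im = τ.im := UpperHalfPlane.coe_im τ
  rw [him] at h
  linarith

/-! ## `U`, `W`, `V` to fourth order -/

/-- `qhalf_isBigO_one` (auxiliary). [folklore] -/
theorem qhalf_isBigO_one : (fun τ => qhalf τ) =O[atImInfty] fun _ : ℍ => (1 : ℝ) :=
  IsBigO.of_bound 1 (Eventually.of_forall fun τ => by simp [norm_qhalf, expDecayHalf_le_one τ])

/-- **`U − 1 − 8q^{1/2} − 24q − 32q^{3/2} = O(e^{−4πy})`** (CKMRV (2.8)), from `θ₀₀ = 1 + 2q^{1/2} + O(e^{−4πy})`.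
[cite: CohnEtAl2019, §2.1.2 (2.8)] -/
theorem thetaU_fourth_order :
    (fun τ : ℍ => thetaU τ - 1 - 8 * qhalf τ - 24 * qhalf τ ^ 2 - 32 * qhalf τ ^ 3) =O[atImInfty]
      fun τ => expDecayHalf τ ^ 4 := by
  have hr := theta3_second_order
  have hq1 := qhalf_isBigO_one
  have hr1 : (fun τ : ℍ => theta3 τ - 1 - 2 * qhalf τ) =O[atImInfty] fun _ : ℍ => (1 : ℝ) :=
    hr.trans (IsBigO.of_bound 1 (Eventually.of_forall fun τ => by
      rw [Real.norm_of_nonneg (pow_nonneg (expDecayHalf_pos τ).le _), norm_one, one_mul]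
      exact pow_le_one₀ (expDecayHalf_pos τ).le (expDecayHalf_le_one τ)))
  set R : ℍ → ℂ := fun τ => theta3 τ - 1 - 2 * qhalf τ with hR
  -- `(1+2b+r)⁴ − 1 − 8b − 24b² − 32b³ = r(4(1+2b)³ + 6(1+2b)²r + 4(1+2b)r² + r³) + 16b⁴`
  have hform : ∀ τ : ℍ, thetaU τ - 1 - 8 * qhalf τ - 24 * qhalf τ ^ 2 - 32 * qhalf τ ^ 3 =
      R τ * (4 * (1 + 2 * qhalf τ) ^ 3 + 6 * (1 + 2 * qhalf τ) ^ 2 * R τ + 4 * (1 + 2 * qhalf τ) * R τ ^ 2 + R τ ^ 3)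
        + 16 * (qhalf τ * qhalf τ * (qhalf τ * qhalf τ)) := by
    intro τ
    rw [thetaU_apply, show theta3 (τ : ℂ) = 1 + 2 * qhalf τ + R τ by rw [hR]; ring]
    ring
  have hb1 : (fun τ => 1 + 2 * qhalf τ) =O[atImInfty] fun _ : ℍ => (1 : ℝ) :=
    (isBigO_const_const (1 : ℂ) one_ne_zero _).add (hq1.const_mul_left 2)
  have hP : (fun τ => 4 * (1 + 2 * qhalf τ) ^ 3 + 6 * (1 + 2 * qhalf τ) ^ 2 * R τ + 4 * (1 + 2 * qhalf τ) * R τ ^ 2 + R τ ^ 3)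
      =O[atImInfty] fun _ : ℍ => (1 : ℝ) := by
    have c3 : (fun τ => (1 + 2 * qhalf τ) ^ 3) =O[atImInfty] fun _ : ℍ => (1 : ℝ) := by
      simpa [pow_succ] using (isBigO_mul_of_isBigO_one (isBigO_mul_of_isBigO_one hb1 hb1) hb1)
    have c2 : (fun τ => (1 + 2 * qhalf τ) ^ 2) =O[atImInfty] fun _ : ℍ => (1 : ℝ) := by
      simpa [sq] using isBigO_mul_of_isBigO_one hb1 hb1
    have r2 : (fun τ => R τ ^ 2) =O[atImInfty] fun _ : ℍ => (1 : ℝ) := by simpa [sq] using isBigO_mul_of_isBigO_one hr1 hr1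
    have r3 : (fun τ => R τ ^ 3) =O[atImInfty] fun _ : ℍ => (1 : ℝ) := by
      simpa [pow_succ] using isBigO_mul_of_isBigO_one (isBigO_mul_of_isBigO_one hr1 hr1) hr1
    have t1 := c3.const_mul_left 4
    have t2 : (fun τ => 6 * (1 + 2 * qhalf τ) ^ 2 * R τ) =O[atImInfty] fun _ : ℍ => (1 : ℝ) := by
      simpa [mul_assoc] using (isBigO_mul_of_isBigO_one c2 hr1).const_mul_left 6
    have t3 : (fun τ => 4 * (1 + 2 * qhalf τ) * R τ ^ 2) =O[atImInfty] fun _ : ℍ => (1 : ℝ) := by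
      simpa [mul_assoc] using (isBigO_mul_of_isBigO_one hb1 r2).const_mul_left 4
    exact ((t1.add t2).add t3).add r3
  have hbb : (fun τ => qhalf τ * qhalf τ * (qhalf τ * qhalf τ)) =O[atImInfty] fun τ => expDecayHalf τ ^ 4 := by
    have h2 : (fun τ => qhalf τ * qhalf τ) =O[atImInfty] fun τ => expDecayHalf τ ^ 2 := by
      simpa [sq] using qhalf_isBigO.mul qhalf_isBigO
    have := h2.mul h2
    exact this.congr_right fun τ => by ring
  have t1 : (fun τ => R τ * (4 * (1 + 2 * qhalf τ) ^ 3 + 6 * (1 + 2 * qhalf τ) ^ 2 * R τ + 4 * (1 + 2 * qhalf τ) * R τ ^ 2 + R τ ^ 3))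
      =O[atImInfty] fun τ => expDecayHalf τ ^ 4 := by simpa using hr.mul hP
  exact (t1.add (hbb.const_mul_left 16)).congr' (Eventually.of_forall fun τ => by beta_reduce; rw [hform τ])
    EventuallyEq.rfl

/-- **`W − 1 + 8q^{1/2} − 24q + 32q^{3/2} = O(e^{−4πy})`** (CKMRV (2.8)), via `W(τ) = U(τ+1)`.
[cite: CohnEtAl2019, §2.1.2 (2.8)] -/
theorem thetaW_fourth_order :
    (fun τ : ℍ => thetaW τ - 1 + 8 * qhalf τ - 24 * qhalf τ ^ 2 + 32 * qhalf τ ^ 3) =O[atImInfty]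
      fun τ => expDecayHalf τ ^ 4 := by
  have h := thetaU_fourth_order.comp_tendsto (tendsto_vadd_atImInfty 1)
  refine (h.congr_left fun τ => ?_).congr_right fun τ => ?_
  · simp only [Function.comp_apply, thetaW_eq_thetaU_vadd, qhalf_vadd_one]; ring
  · simp only [Function.comp_apply, expDecayHalf_vadd]

/-- **`V − 16q^{1/2} − 64q^{3/2} = O(e^{−5πy})`** (CKMRV (2.8)), from `V = q^{1/2}θ(τ/2,τ)⁴` and
`θ(τ/2,τ) = 2 + 2q + O(e^{−6πy})`. [cite: CohnEtAl2019, §2.1.2 (2.8)] -/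
theorem thetaV_fourth_order :
    (fun τ : ℍ => thetaV τ - 16 * qhalf τ - 64 * qhalf τ ^ 3) =O[atImInfty] fun τ => expDecayHalf τ ^ 5 := by
  have hJ := jacobiTheta₂_half_fourth_order
  have hq1 := qhalf_isBigO_one
  have hq := qhalf_isBigO
  have hJ1 : (fun τ : ℍ => jacobiTheta₂ ((τ : ℂ) / 2) τ - 2 - 2 * qfun τ) =O[atImInfty] fun _ : ℍ => (1 : ℝ) :=
    hJ.trans (IsBigO.of_bound 1 (Eventually.of_forall fun τ => by
      rw [Real.norm_of_nonneg (pow_nonneg (expDecayHalf_pos τ).le _), norm_one, one_mul]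
      exact pow_le_one₀ (expDecayHalf_pos τ).le (expDecayHalf_le_one τ)))
  have hqq1 : (fun τ => qfun τ) =O[atImInfty] fun _ : ℍ => (1 : ℝ) :=
    IsBigO.of_bound 1 (Eventually.of_forall fun τ => by simp [norm_qfun, expDecay_le_one τ])
  set Sfun : ℍ → ℂ := fun τ => jacobiTheta₂ ((τ : ℂ) / 2) τ - 2 - 2 * qfun τ with hS
  -- `V − 16b − 64b³ = b·[(2+2q+S)⁴ − (2+2q)⁴] + b·[(2+2q)⁴ − 16 − 64q]`, `q = b²`
  have hform : ∀ τ : ℍ, thetaV τ - 16 * qhalf τ - 64 * qhalf τ ^ 3 =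
      qhalf τ * (Sfun τ * (4 * (2 + 2 * qfun τ) ^ 3 + 6 * (2 + 2 * qfun τ) ^ 2 * Sfun τ + 4 * (2 + 2 * qfun τ) * Sfun τ ^ 2 + Sfun τ ^ 3))
      + qhalf τ * (qfun τ * qfun τ) * (96 + 64 * qfun τ + 16 * qfun τ ^ 2) := by
    intro τ
    rw [thetaV_eq_qhalf_mul, show jacobiTheta₂ ((τ : ℂ) / 2) τ = 2 + 2 * qfun τ + Sfun τ by rw [hS]; ring, ← qhalf_sq]
    ring
  have hb1 : (fun τ => 2 + 2 * qfun τ) =O[atImInfty] fun _ : ℍ => (1 : ℝ) :=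
    (isBigO_const_const (2 : ℂ) one_ne_zero _).add (hqq1.const_mul_left 2)
  have hP : (fun τ => 4 * (2 + 2 * qfun τ) ^ 3 + 6 * (2 + 2 * qfun τ) ^ 2 * Sfun τ + 4 * (2 + 2 * qfun τ) * Sfun τ ^ 2 + Sfun τ ^ 3)
      =O[atImInfty] fun _ : ℍ => (1 : ℝ) := by
    have c3 : (fun τ => (2 + 2 * qfun τ) ^ 3) =O[atImInfty] fun _ : ℍ => (1 : ℝ) := by
      simpa [pow_succ] using (isBigO_mul_of_isBigO_one (isBigO_mul_of_isBigO_one hb1 hb1) hb1)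
    have c2 : (fun τ => (2 + 2 * qfun τ) ^ 2) =O[atImInfty] fun _ : ℍ => (1 : ℝ) := by
      simpa [sq] using isBigO_mul_of_isBigO_one hb1 hb1
    have r2 : (fun τ => Sfun τ ^ 2) =O[atImInfty] fun _ : ℍ => (1 : ℝ) := by simpa [sq] using isBigO_mul_of_isBigO_one hJ1 hJ1
    have r3 : (fun τ => Sfun τ ^ 3) =O[atImInfty] fun _ : ℍ => (1 : ℝ) := by
      simpa [pow_succ] using isBigO_mul_of_isBigO_one (isBigO_mul_of_isBigO_one hJ1 hJ1) hJ1
    have t2 : (fun τ => 6 * (2 + 2 * qfun τ) ^ 2 * Sfun τ) =O[atImInfty] fun _ : ℍ => (1 : ℝ) := by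
      simpa [mul_assoc] using (isBigO_mul_of_isBigO_one c2 hJ1).const_mul_left 6
    have t3 : (fun τ => 4 * (2 + 2 * qfun τ) * Sfun τ ^ 2) =O[atImInfty] fun _ : ℍ => (1 : ℝ) := by
      simpa [mul_assoc] using (isBigO_mul_of_isBigO_one hb1 r2).const_mul_left 4
    exact (((c3.const_mul_left 4).add t2).add t3).add r3
  have t1 : (fun τ => qhalf τ * (Sfun τ * (4 * (2 + 2 * qfun τ) ^ 3 + 6 * (2 + 2 * qfun τ) ^ 2 * Sfun τ +
      4 * (2 + 2 * qfun τ) * Sfun τ ^ 2 + Sfun τ ^ 3))) =O[atImInfty] fun τ => expDecayHalf τ ^ 5 := by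
    have h7 : (fun τ => qhalf τ * (Sfun τ * (4 * (2 + 2 * qfun τ) ^ 3 + 6 * (2 + 2 * qfun τ) ^ 2 * Sfun τ +
        4 * (2 + 2 * qfun τ) * Sfun τ ^ 2 + Sfun τ ^ 3))) =O[atImInfty] fun τ => expDecayHalf τ ^ 7 := by
      have := hq.mul (hJ.mul hP)
      exact this.congr_right fun τ => by ring
    exact h7.trans (expDecayHalf_pow_isBigO_pow (by norm_num))
  have t2 : (fun τ => qhalf τ * (qfun τ * qfun τ) * (96 + 64 * qfun τ + 16 * qfun τ ^ 2)) =O[atImInfty]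
      fun τ => expDecayHalf τ ^ 5 := by
    have hqf : (fun τ => qfun τ) =O[atImInfty] fun τ => expDecayHalf τ ^ 2 :=
      IsBigO.of_bound 1 (Eventually.of_forall fun τ => by
        rw [norm_qfun, expDecay_eq_sq, Real.norm_of_nonneg (sq_nonneg _), one_mul])
    have hb : (fun τ => 96 + 64 * qfun τ + 16 * qfun τ ^ 2) =O[atImInfty] fun _ : ℍ => (1 : ℝ) := by
      have c2 : (fun τ => qfun τ ^ 2) =O[atImInfty] fun _ : ℍ => (1 : ℝ) := by simpa [sq] using isBigO_mul_of_isBigO_one hqq1 hqq1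
      exact ((isBigO_const_const (96 : ℂ) one_ne_zero _).add (hqq1.const_mul_left 64)).add (c2.const_mul_left 16)
    have := (hq.mul (hqf.mul hqf)).mul hb
    exact this.congr_right fun τ => by ring
  exact (t1.add t2).congr' (Eventually.of_forall fun τ => by beta_reduce; rw [hform τ]) EventuallyEq.rfl

/-! ## `λ` to fourth order -/

/-- **`λ − 16q^{1/2} + 128q − 704q^{3/2} = O(e^{−4πy})`** (CKMRV (2.9)): with
`P_V = 16b + 64b³`, `P_U = 1 + 8b + 24b² + 32b³`, `P_λ = 16b − 128b² + 704b³` one has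
`P_V − P_λP_U = −b⁴(3072 + 12800b + 22528b²)`, an explicit multiple of `b⁴`, and
`λ − P_λ = ((V − P_V) − P_λ(U − P_U) + (P_V − P_λP_U))/U`. [cite: CohnEtAl2019, §2.1.2 (2.9)] -/
theorem modularLambda_fourth_order :
    (fun τ : ℍ => modularLambda τ - 16 * qhalf τ + 128 * qhalf τ ^ 2 - 704 * qhalf τ ^ 3) =O[atImInfty]
      fun τ => expDecayHalf τ ^ 4 := by
  have hV := thetaV_fourth_order.trans (expDecayHalf_pow_isBigO_pow (m := 5) (n := 4) (by norm_num))
  have hU := thetaU_fourth_order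
  have hq := qhalf_isBigO
  have hq1 := qhalf_isBigO_one
  have hPl : (fun τ => 16 * qhalf τ - 128 * qhalf τ ^ 2 + 704 * qhalf τ ^ 3) =O[atImInfty] fun _ : ℍ => (1 : ℝ) := by
    have c2 : (fun τ => qhalf τ ^ 2) =O[atImInfty] fun _ : ℍ => (1 : ℝ) := by simpa [sq] using isBigO_mul_of_isBigO_one hq1 hq1
    have c3 : (fun τ => qhalf τ ^ 3) =O[atImInfty] fun _ : ℍ => (1 : ℝ) := by
      simpa [pow_succ] using isBigO_mul_of_isBigO_one (isBigO_mul_of_isBigO_one hq1 hq1) hq1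
    exact ((hq1.const_mul_left 16).sub (c2.const_mul_left 128)).add (c3.const_mul_left 704)
  have hN : (fun τ => (thetaV τ - 16 * qhalf τ - 64 * qhalf τ ^ 3)
      - (16 * qhalf τ - 128 * qhalf τ ^ 2 + 704 * qhalf τ ^ 3) * (thetaU τ - 1 - 8 * qhalf τ - 24 * qhalf τ ^ 2 - 32 * qhalf τ ^ 3)
      + qhalf τ ^ 4 * (-3072 - 12800 * qhalf τ - 22528 * qhalf τ ^ 2)) =O[atImInfty] fun τ => expDecayHalf τ ^ 4 := by
    have t2 : (fun τ => (16 * qhalf τ - 128 * qhalf τ ^ 2 + 704 * qhalf τ ^ 3) *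
        (thetaU τ - 1 - 8 * qhalf τ - 24 * qhalf τ ^ 2 - 32 * qhalf τ ^ 3)) =O[atImInfty] fun τ => expDecayHalf τ ^ 4 :=
      isBigO_mul_of_isBigO_one hPl hU
    have t3 : (fun τ => qhalf τ ^ 4 * (-3072 - 12800 * qhalf τ - 22528 * qhalf τ ^ 2)) =O[atImInfty]
        fun τ => expDecayHalf τ ^ 4 := by
      have h4 : (fun τ => qhalf τ ^ 4) =O[atImInfty] fun τ => expDecayHalf τ ^ 4 := by simpa using hq.pow 4
      have hb : (fun τ => -3072 - 12800 * qhalf τ - 22528 * qhalf τ ^ 2) =O[atImInfty] fun _ : ℍ => (1 : ℝ) := by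
        have c2 : (fun τ => qhalf τ ^ 2) =O[atImInfty] fun _ : ℍ => (1 : ℝ) := by simpa [sq] using isBigO_mul_of_isBigO_one hq1 hq1
        exact ((isBigO_const_const (-3072 : ℂ) (by norm_num) _).sub (hq1.const_mul_left 12800)).sub (c2.const_mul_left 22528)
      have := h4.mul hb
      simpa using this
    exact (hV.sub t2).add t3
  refine (isBigO_div_thetaU hN).congr' (Eventually.of_forall fun τ => ?_) EventuallyEq.rfl
  have hU0 := thetaU_ne_zero τ
  simp only [modularLambda]
  field_simp
  ring

end Literature.NumberTheory.ModularForms
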